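import Literature.AlgebraicGeometry.Tropical.KugaSatakeLinearFamily
import Literature.AlgebraicGeometry.Tropical.TropicalTorusWeilCycles
import HarnessLib

/-!
# Route `TropicalKugaSatakeCayley` — definitions posited by the line `formal_rational` of the crux
# `EffectiveCayleyNonRealizability` (stmt-HodgeConjecture-18569): formal chains of the Kuga–Satake
# family and their evaluation

The registered line `Cruxes/EffectiveCayleyNonRealizability/Lines/formal_rational.lean` states its
stubs over three skeleton-local devices, promoted here verbatim (same bodies) so that Theorems files
can state the registered signatures literally:

* `ksMatrixPoly` — the GENERIC period matrix of the Kuga–Satake linear family as a matrix of linear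
  forms, `B_t = Σ_i t_i • ksForm i ∈ M₈(ℚ[t₀,…,t₄])` (Kontsevich–Zharkov: tropical cycles "which vary
  rationally over the space of parameters" live over this matrix; Zharkov p. 3);
* `evalCell`, `evalChain` — evaluation of a formal framed cell / chain (coordinates in
  `ℚ[t₀,…,t₄]`, `Literature.AlgebraicGeometry.Tropical.TropicalTorus.Cell/Chain`) at a real
  parameter `t ∈ ℝ⁵`: base vertex and edge coefficients through `MvPolynomial.aeval t`, rational
  direction frame and weight kept.

Facts about them (evaluation of `ksMatrixPoly` is `ksMatrix`, the identity principle, the rational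
formalisation) are in `Theorems/TropicalKugaSatakeCayleyEffectiveCayleyNonRealizability*.lean`,
stated with these bodies unfolded. Definitions only; no statement is claimed here.

References: [Zharkov2020TropicalWeil] I. Zharkov, Tropical abelian varieties, Weil classes and the
Hodge conjecture, arXiv:2002.02347, p. 3; [MikhalkinZharkov2014Eigenwave] G. Mikhalkin, I. Zharkov,
Tropical eigenwave and intermediate Jacobians, LN UMI 15 (2014), Def. 4.2.
-/

noncomputable section

-- `Summit.HodgeConjecture.HodgeConjecture.…` is the mandated namespace (single-conjunct summit).
set_option linter.dupNamespace false

open scoped BigOperators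

namespace Summit.HodgeConjecture.HodgeConjecture.Theorems.TropicalKugaSatakeCayley

open Literature.AlgebraicGeometry.Tropical Literature.AlgebraicGeometry.Tropical.TropicalTorus

/-- The GENERIC period matrix of the Kuga–Satake linear family as a matrix of linear forms:
`B_t = Σ_i t_i • ksForm i` with `t_i` the variables of `ℚ[t₀,…,t₄]` (its evaluation at `t ∈ ℝ⁵` is
`ksMatrix t`). [cite: Zharkov2020TropicalWeil, p. 3] -/
def ksMatrixPoly : Matrix (Fin 8) (Fin 8) (MvPolynomial (Fin 5) ℚ) :=
  ∑ i : Fin 5, (MvPolynomial.X i : MvPolynomial (Fin 5) ℚ) •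
    (ksForm i).map (Int.cast : ℤ → MvPolynomial (Fin 5) ℚ)

/-- Evaluation of a formal framed cell (coordinates in `ℚ[t₀,…,t₄]`) at a real parameter `t ∈ ℝ⁵`:
base vertex and edge coefficients through `aeval t`, the rational direction frame and the weight are
kept. [cite: Zharkov2020TropicalWeil, p. 3] -/
def evalCell (t : Fin 5 → ℝ) (c : Cell (MvPolynomial (Fin 5) ℚ) 8 2) : Cell ℝ 8 2 where
  base := fun r => MvPolynomial.aeval t (c.base r)
  dir := c.dir
  coef := fun i j => MvPolynomial.aeval t (c.coef i j)
  weight := c.weight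

/-- Evaluation of a formal framed chain at a real parameter `t ∈ ℝ⁵` (cellwise `evalCell`).
[cite: Zharkov2020TropicalWeil, p. 3] -/
def evalChain (t : Fin 5 → ℝ) (Z : Chain (MvPolynomial (Fin 5) ℚ) 8 2) : Chain ℝ 8 2 :=
  ⟨Z.size, fun c => evalCell t (Z.cell c)⟩

/-- `evalChain` keeps the number of cells. [folklore] -/
theorem evalChain_size (t : Fin 5 → ℝ) (Z : Chain (MvPolynomial (Fin 5) ℚ) 8 2) :
    (evalChain t Z).size = Z.size := rfl

/-- `evalCell` keeps the framing `weight · (D₁ ∧ D₂)` (it only involves the rational frame and the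
weight). [folklore] -/
theorem evalCell_framing (t : Fin 5 → ℝ) (c : Cell (MvPolynomial (Fin 5) ℚ) 8 2) :
    (evalCell t c).framing = c.framing := rfl

/-! ### The six-parameter family `F₊ = F_KS ⊕ ℚ B₆` (devices of the rung `stub_rung_sixthDirection`)

The line's plan-only rung `stub_rung_sixthDirection` is stated over four further skeleton-local
devices, promoted here verbatim (same bodies as in
`Cruxes/EffectiveCayleyNonRealizability/Lines/formal_rational.lean`). The rung itself is proved in
`Theorems/TropicalKugaSatakeCayleyEffectiveCayleyNonRealizabilitySixthDirectionRung.lean` with these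
bodies unfolded. -/

/-- The sixth direction `B₆ = B₁ ω`, `ω = R₂ R₃ R₄ R₅` (integral; `F₊ = F_KS ⊕ ℚ B₆` is the family of
all `D`-compatible symmetric forms of the prior programme, §5; as a matrix, the antidiagonal
`(…, ∓16, …)`). [cite: Zharkov2020TropicalWeil, p. 2] -/
def ksSixth : Matrix (Fin 8) (Fin 8) ℤ :=
  ksBase * ksClifford 0 * ksClifford 1 * ksClifford 2 * ksClifford 3

/-- The six-parameter period matrix `Σ_{i<5} s_i ksForm i + s_5 B₆` at `s ∈ ℝ⁶`.
[cite: Zharkov2020TropicalWeil, p. 2] -/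
def ksMatrixPlus (s : Fin 6 → ℝ) : Matrix (Fin 8) (Fin 8) ℝ :=
  (∑ i : Fin 5, s (Fin.castSucc i) • (ksForm i).map (Int.cast : ℤ → ℝ)) +
    s (Fin.last 5) • ksSixth.map (Int.cast : ℤ → ℝ)

/-- The six-parameter period matrix as a matrix of linear forms in `ℚ[s₀,…,s₅]`.
[cite: Zharkov2020TropicalWeil, p. 3] -/
def ksMatrixPlusPoly : Matrix (Fin 8) (Fin 8) (MvPolynomial (Fin 6) ℚ) :=
  (∑ i : Fin 5, (MvPolynomial.X (Fin.castSucc i) : MvPolynomial (Fin 6) ℚ) •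
      (ksForm i).map (Int.cast : ℤ → MvPolynomial (Fin 6) ℚ)) +
    (MvPolynomial.X (Fin.last 5) : MvPolynomial (Fin 6) ℚ) •
      ksSixth.map (Int.cast : ℤ → MvPolynomial (Fin 6) ℚ)

/-- Evaluation of a six-parameter formal framed cell (coordinates in `ℚ[s₀,…,s₅]`) at `s ∈ ℝ⁶`
(base vertex and edge coefficients through `aeval s`; frame and weight kept).
[cite: Zharkov2020TropicalWeil, p. 3] -/
def evalCell₆ (s : Fin 6 → ℝ) (c : Cell (MvPolynomial (Fin 6) ℚ) 8 2) : Cell ℝ 8 2 where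
  base := fun r => MvPolynomial.aeval s (c.base r)
  dir := c.dir
  coef := fun i j => MvPolynomial.aeval s (c.coef i j)
  weight := c.weight

/-- Evaluation of a six-parameter formal framed chain at `s ∈ ℝ⁶` (cellwise `evalCell₆`).
[cite: Zharkov2020TropicalWeil, p. 3] -/
def evalChain₆ (s : Fin 6 → ℝ) (Z : Chain (MvPolynomial (Fin 6) ℚ) 8 2) : Chain ℝ 8 2 :=
  ⟨Z.size, fun c => evalCell₆ s (Z.cell c)⟩

/-- `evalChain₆` keeps the number of cells. [folklore] -/
theorem evalChain₆_size (s : Fin 6 → ℝ) (Z : Chain (MvPolynomial (Fin 6) ℚ) 8 2) :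
    (evalChain₆ s Z).size = Z.size := rfl

end Summit.HodgeConjecture.HodgeConjecture.Theorems.TropicalKugaSatakeCayley

end
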